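import Summits.Ventures.LatticeQCDFlow.Scoring.UNFreeEnergyWeakCoupling2D
import Summits.Ventures.LatticeQCDFlow.Scoring.MehtaIntegral
import HarnessLib

/-!
# The weak-coupling constants of two-dimensional `U(N)` lattice Yang–Mills in closed form, every `N`: `Z_N(x) ~ sf(N)/(N! (2π)^{N/2}) · e^{Nx} x^{−N²/2}` and `f_N(β) = −(N²/2) log β + log sf(N−1) − (N/2) log 2π + o(1)`

HONEST FRAMING: exact (Metropolis-corrected) sampling algorithms for lattice gauge theory;
figures of merit are autocorrelation/cost numbers at stated couplings and volumes; no
continuum-physics claim.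

Venture `LatticeQCDFlow` (cell pub-lqcd), sub-topic `Scoring`; FANOUT row 5 (`s0-sun-a`), GEN-20.
NEW WORK of the cell (placement rule).  GEN-20's `BesselToeplitzLaplace` / `UNFreeEnergyWeakCoupling2D` gave the
weak-coupling laws with Mehta's integral `M_N` as an unevaluated positive Gaussian integral; `MehtaIntegral` evaluates
`M_N = √(2π)^N sf(N)` (`sf(N) = Π_{j=1}^{N} j!`, Mathlib's `Nat.superFactorial`).  Substituting:

* **`tendsto_det_besselI_toeplitz_weakCoupling'`** — for every `N`, as `x → ∞`,
  `det[I_{|i−j|}(x)]_{i,j<N} · e^{−Nx} · √x^{N²} → sf(N) / (N! · √(2π)^N)` (`= Π_{j=1}^{N−1} j! / (2π)^{N/2}` for `N ≥ 1`: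
  the Gross–Witten weak-coupling constant at FINITE `N`);
* **`tendsto_unitary_freeEnergyDensity_two_add_log'`** — for every `N`, as `β → ∞`,
  `freeEnergyDensity 2 ρ_{U(N)} β + (N²/2) log β → log (sf(N) / (N! · √(2π)^N))`;
* `unitary_one_weakCoupling_constant` — consistency at `N = 1`: the constant is `−½ log 2π` (GEN-20 (29)).

No `def`, nothing cited as a fact, 0 sorry.
-/

noncomputable section

open Real MeasureTheory Filter Topology
open Literature.MathematicalPhysics.QuantumLattice (unitaryFundamentalRep freeEnergyDensity)
open Literature.Analysis.FunctionSpaces (besselI)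

namespace Summit.Ventures.LatticeQCDFlow.Scoring

/-- `M_N / ((2π)^N N!) = sf(N) / (N! √(2π)^N)`. -/
theorem gaussVandermonde_div_eq (N : ℕ) :
    (√(2 * π) ^ N * (N.superFactorial : ℝ)) / ((2 * π) ^ N * N.factorial)
      = (N.superFactorial : ℝ) / (N.factorial * √(2 * π) ^ N) := by
  have h2π : (0 : ℝ) < 2 * π := by positivity
  have hs : 0 < √(2 * π) := Real.sqrt_pos.2 h2π
  have hsq : (2 * π : ℝ) ^ N = √(2 * π) ^ N * √(2 * π) ^ N := by
    rw [← mul_pow, Real.mul_self_sqrt h2π.le]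
  rw [hsq, div_eq_div_iff (by positivity) (by positivity)]
  ring

/-- **THE WEAK-COUPLING LAW OF THE `U(N)` ONE-PLAQUETTE PARTITION FUNCTION IN CLOSED FORM, EVERY `N`**:
`det[I_{|i−j|}(x)]_{i,j<N} · e^{−Nx} · √x^{N²} → sf(N) / (N! · √(2π)^N)` as `x → ∞`
(`sf(N)/N! = Π_{j=1}^{N−1} j!`; Gross–Witten weak coupling at finite `N`). -/
theorem tendsto_det_besselI_toeplitz_weakCoupling' (N : ℕ) :
    Tendsto (fun x : ℝ => (Matrix.of fun i j : Fin N => besselI ((i : ℤ) - (j : ℤ)).natAbs x).det *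
        Real.exp (-(N * x)) * √x ^ (N ^ 2)) atTop
      (𝓝 ((N.superFactorial : ℝ) / (N.factorial * √(2 * π) ^ N))) := by
  have h := tendsto_det_besselI_toeplitz_weakCoupling N
  rwa [gaussVandermonde_eq_superFactorial, gaussVandermonde_div_eq] at h

/-- **THE WEAK-COUPLING ASYMPTOTICS OF THE 2-d `U(N)` FREE ENERGY IN CLOSED FORM, EVERY `N`**:
`freeEnergyDensity 2 ρ_{U(N)} β + (N²/2) log β → log (sf(N) / (N! · √(2π)^N))` as `β → ∞`, i.e.
`f_N(β) = −(N²/2) log β + log Π_{j=1}^{N−1} j! − (N/2) log 2π + o(1)`. -/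
theorem tendsto_unitary_freeEnergyDensity_two_add_log' (N : ℕ) :
    Tendsto (fun β : ℝ => freeEnergyDensity 2 (unitaryFundamentalRep (Fin N) ℂ) β + (N : ℝ) ^ 2 / 2 * Real.log β)
      atTop (𝓝 (Real.log ((N.superFactorial : ℝ) / (N.factorial * √(2 * π) ^ N)))) := by
  have h := tendsto_unitary_freeEnergyDensity_two_add_log N
  rwa [gaussVandermonde_eq_superFactorial, gaussVandermonde_div_eq] at h

/-- Consistency at `N = 1`: the closed-form constant is `log (1/√(2π)) = −½ log 2π`, GEN-20 (29)'s `U(1)` constant. -/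
theorem unitary_one_weakCoupling_constant :
    Real.log (((1 : ℕ).superFactorial : ℝ) / ((1 : ℕ).factorial * √(2 * π) ^ 1)) = -(Real.log (2 * π) / 2) := by
  have h2π : (0 : ℝ) < 2 * π := by positivity
  simp only [Nat.superFactorial_one, Nat.factorial_one, Nat.cast_one, one_mul, pow_one]
  rw [Real.log_div one_ne_zero (Real.sqrt_pos.2 h2π).ne', Real.log_one, Real.log_sqrt h2π.le]
  ring

end Summit.Ventures.LatticeQCDFlow.Scoring
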